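import Summits.ResolutionOfSingularities.ResolutionOfSingularities.Theorems.HomologicalConductorNoZenoBirthDefs
import Summits.ResolutionOfSingularities.ResolutionOfSingularities.Theorems.HomologicalConductorNoZenoNoetherianCase
import Summits.ResolutionOfSingularities.ResolutionOfSingularities.Theorems.HomologicalConductorNoZenoTowerNoetherian
import Summits.ResolutionOfSingularities.ResolutionOfSingularities.Theorems.HomologicalConductorNoZenoDominanceInvariance
import Summits.ResolutionOfSingularities.ResolutionOfSingularities.Theorems.HomologicalConductorNoZenoMaxDominator
import Summits.ResolutionOfSingularities.ResolutionOfSingularities.Theorems.HomologicalConductorNoZenoRelativeACC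
import Literature.AlgebraicGeometry.Resolution.DivisorialPlace
import Literature.AlgebraicGeometry.Resolution.AffineDomainDimension
import Literature.AlgebraicGeometry.Resolution.FieldsJ2
import Literature.RingTheory.CohomologyAnnihilator.AnnihilationOfCohomology
import HarnessLib

/-!
# Crux `NoZeno` (stmt-ResolutionOfSingularities-16483) — line `birth`, skeleton v4 (lead c1, 2026-08-17)

Route `ResolutionOfSingularities/HomologicalConductor`; crux BY NAME
`Summit.ResolutionOfSingularities.ResolutionOfSingularities.Theses.HomologicalConductor.NoZeno`
(valuative termination of the canonical normalised `ca`-tower `T₀ = A_centre`,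
`T_(m+1) = (normalisation of T_m[ca(T_m)/x])_centre`, given `Persistence` and `StrictDrop`).

## History
v1 (planner): stubs noetherian `O` | rank-one `O` | rank reduction. v2 (lead 0): cut by
DOMINATION — `stub_noetherianCase` (p167613), `stub_towerNoetherian` (p167526),
`stub_dominanceInvariance` (p168418) LANDED; open: `stub_kernel` = the crux restricted to towers
dominated by no noetherian valuation ring (certificate `noZeno_iff_kernel`, p169100).

## v3 (this file): the kernel cut by COARSENING (maximal dominator + relative chain condition)

Two levers beyond order theory along `O` itself:

* **Maximal dominator (WLOG).** The valuation rings `O' ≥ O` dominating the `O`-tower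
  (`T_m ⊆ O'` and `O'`-units of `T_m` are `O`-units) form a non-empty up-... Zorn-closed family
  (a union of a chain of dominators dominates); a MAXIMAL one `O⋆` has the same tower
  (dominance invariance) and NO proper overring `O' > O⋆` dominates: every coarsening of `O⋆`
  eventually has NON-maximal centre on the tower. (`stub_maxDominator`, provable now.)
* **Relative chain condition.** `StrictDrop` alone terminates the tower as soon as some
  `ca(T_m)` contains a nonzero `c` that is a unit of an overring `U ≥ O` modulo which `O` has
  no infinite strictly ascending chain of principal ideals generated by `U`-units
  (`stub_relativeACC`, provable now: the drops of `StrictDrop` stay inside the `U`-units and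
  would form such a chain). With `U = O⋆₁` the rank-one-less coarsening this is exactly the
  ARITHMETIC input the disprover asked for (Disproof F1: the discrete rank-two Zeno sequence
  `(1,-m)` lives in the first coordinate; it is excluded the moment `ca(T_m)` leaves the centre
  of the coarsening, e.g. on normal SURFACES where `ca` is `𝔪`-primary and that centre is a
  height-one prime — IyengarTakahashi2014 Thm 5.4).

So the open content splits into

* `stub_kernelRankOne` — `O` maximal dominator of RANK ONE (no overring strictly between `O`
  and `K`), non-noetherian: the crux's named risk (non-discrete rank one, defect), verbatim;
* `stub_kernelCompositeCore` — `O` maximal dominator of rank ≥ 2 such that for EVERY overring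
  `U ≥ O` in which some nonzero element of some `ca(T_m)` becomes a unit, `O` carries an
  infinite strictly ascending chain of principal ideals generated by `U`-units (the residual
  valuation `O/𝔭_U` is non-discrete) — in dimension 2 this is vacuous modulo
  IyengarTakahashi2014 Thm 5.4 (then `U = O₁`, the rank-one coarsening, is a DVR with height-one
  centre, `ca(T_m) ⊄` centre, and `O/𝔭_U` is a DVR of a function field of a curve).

Composition `NoZeno_of` (PROVED below from the landed stubs + the four v3 stubs): noetherian
dominator ⇒ v2 argument; else pass to `O⋆` (invariance), try the relative chain condition,
else split on the rank of `O⋆`.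

Disproof used: `Cruxes/NoZeno/Disproof.lean` cycle 1 (F0 unfalsifiable in isolation; F1/F1′ order
skeleton ⟺ noetherian — v3's `stub_relativeACC` is F1's positive half RELATIVISED to a coarsening;
F2 `A.FG` kept everywhere; no `-- Targets` on v2/v3 stubs yet).

## v4 (this revision): dimension bookkeeping makes the dimension-2 composite case PROVABLE

`stub_maxDominator` (p172546) and `stub_relativeACC` (p172572) LANDED (wave 1). The composite
stub is cut by transcendence degree (`Cruxes/NoZeno/KERNEL-c1.md` §3): with `n = trdeg_k K`
(`= dim A`),
* `stub_kernelLowDim` (`n ≤ 1`, provable): every valuation ring of `K/k` is then noetherian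
  (field or DVR: Zariski–Samuel VI §14 Thm 31 via the tree's `isDiscreteValuationRing_of_residueTrdeg`
  + `residueTrdeg_add_one_eq_of_trdeg_le_one`), contradicting the kernel hypothesis;
* `n = 2`, composite: for an intermediate `O < O₁ < K` the centre `𝔭` of `O₁` on a normal stage
  past the maximality witness is a height-one prime, so `(T_m)_𝔭` is a DVR (`stub_dim2RegularCentre`,
  provable); `V(ca) = Sing` (IyengarTakahashi2014 Thm 5.4 = `stub_singEqVCa`, the tree's named-fact
  debt `singEqVCa_essFiniteType`) then puts a unit of `O₁` into `ca(T_m)` (`stub_unitOfRegularCentre`,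
  provable from the fact, any dimension); and the residual valuation `O/𝔪_{O₁}` of the prime divisor
  `O₁` is a DVR of a function field of one variable, so `O` has the relative chain condition
  (`stub_dim2ResidualACC`, provable) — and `stub_relativeACC` terminates the tower;
* `stub_kernelRankOne` (`n ≥ 2`, rank one) and `stub_kernelCompositeHighDim` (`n ≥ 3`) carry the
  open content.
-/

-- single-problem summit: the doubled namespace component `ResolutionOfSingularities` is forced
set_option linter.dupNamespace false

noncomputable section

open Summit.ResolutionOfSingularities.ResolutionOfSingularities.Theses.HomologicalConductor

namespace Summit.ResolutionOfSingularities.ResolutionOfSingularities.Cruxes.NoZeno.Lines.Birth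

open Summit.ResolutionOfSingularities.ResolutionOfSingularities.Theorems.NoZeno.Birth

section Vocabulary

variable {k K : Type} [Field k] [Field K] [Algebra k K]

/-- `A ≤ loc O A = T₀`: `a = a * 1⁻¹` with `1⁻¹ = 1 ∈ O`. [folklore] -/
theorem le_tower_zero (O : ValuationSubring K) (A : Subalgebra k K) : A ≤ tower O A 0 := by
  intro a ha
  refine Algebra.subset_adjoin ⟨a, ha, 1, A.one_mem, ?_, ?_⟩
  · rw [inv_one]; exact O.one_mem
  · rw [inv_one, mul_one]

end Vocabulary

/-! ## Stub STATEMENTS by name (`Sig.stub_*`; `NoZeno_of` takes exactly these) -/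

/-- Statement of `stub_maxDominator` (v3 glue, provable now): a maximal valuation ring
dominating the `O`-tower exists. [cite: ZariskiSamuel1960, VI §5] -/
def Sig.stub_maxDominator : Prop :=
  ∀ (k K : Type) [Field k] [Field K] [Algebra k K] (O : ValuationSubring K) (A : Subalgebra k K),
    (∀ c : k, algebraMap k K c ∈ O) → A.toSubring ≤ O.toSubring →
    ∃ Om : ValuationSubring K, O ≤ Om ∧
      (∀ m : ℕ, ∀ s ∈ tower O A m, s ∈ Om ∧ (s⁻¹ ∈ Om → s⁻¹ ∈ O)) ∧
      ∀ O' : ValuationSubring K, Om < O' → ∃ m : ℕ, ∃ s ∈ tower O A m, s⁻¹ ∈ O' ∧ s⁻¹ ∉ Om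

/-- Statement of `stub_relativeACC` (v3, provable now): `StrictDrop` terminates the tower as soon
as some `ca(T_m)` holds a nonzero unit of an overring `U ≥ O` such that `O` has no infinite
strictly ascending chain of principal ideals generated by `U`-units. [cite: ZariskiSamuel1960, VI §10] -/
def Sig.stub_relativeACC : Prop :=
  StrictDrop → ∀ p : ℕ, p.Prime → ∀ (k K : Type) [Field k] [CharP k p] [Field K]
    [Algebra k K] (O : ValuationSubring K) (A : Subalgebra k K), (∀ c : k, algebraMap k K c ∈ O) →
    A.FG → IsFractionRing ↥A K → A.toSubring ≤ O.toSubring →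
    ∀ U : ValuationSubring K, O ≤ U →
    (∃ m : ℕ, ∃ c ∈ ca (tower O A m), c ≠ 0 ∧ c⁻¹ ∈ U) →
    (∀ z : ℕ → K, (∀ n : ℕ, z n ∈ O ∧ z n ≠ 0 ∧ (z n)⁻¹ ∈ U) →
      (∀ n : ℕ, z n * (z (n + 1))⁻¹ ∈ O) → ∃ n : ℕ, z (n + 1) * (z n)⁻¹ ∈ O) →
    ∃ m : ℕ, IsRegularLocalRing ↥(tower O A m)

/-- Statement of `stub_kernelLowDim` (v4, provable now): in transcendence degree `≤ 1` the kernel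
hypothesis is contradictory (every valuation ring of `K/k` is noetherian). [cite: ZariskiSamuel1960, Ch. VI §14, Thm. 31] -/
def Sig.stub_kernelLowDim : Prop :=
  ∀ (k K : Type) [Field k] [Field K] [Algebra k K] (O : ValuationSubring K) (A : Subalgebra k K),
    (∀ c : k, algebraMap k K c ∈ O) → A.FG → IsFractionRing ↥A K → A.toSubring ≤ O.toSubring →
    (∀ O' : ValuationSubring K,
      (∀ m : ℕ, ∀ s ∈ tower O A m, s ∈ O' ∧ (s⁻¹ ∈ O' → s⁻¹ ∈ O)) → ¬ IsNoetherianRing ↥O') →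
    Algebra.trdeg k K ≤ 1 → ∃ m : ℕ, IsRegularLocalRing ↥(tower O A m)

/-- Statement of `stub_singEqVCa` (v4; the tree's named-fact debt IyengarTakahashi2014 Thm 5.4,
`Literature.RingTheory.CohomologyAnnihilator.singEqVCa_essFiniteType`). [cite: IyengarTakahashi2014, Thm. 5.4] -/
def Sig.stub_singEqVCa : Prop :=
  Literature.RingTheory.CohomologyAnnihilator.singEqVCa_essFiniteType.{0}

/-- Statement of `stub_unitOfRegularCentre` (v4, provable from Thm 5.4, any dimension): if the
centre `𝔭` of an overring `U ≥ O` on a stage `T_m` has regular local ring, some nonzero element of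
`ca(T_m)` is a unit of `U`. [cite: IyengarTakahashi2014, Thm. 5.4] -/
def Sig.stub_unitOfRegularCentre : Prop :=
  Literature.RingTheory.CohomologyAnnihilator.singEqVCa_essFiniteType.{0} →
  ∀ (k K : Type) [Field k] [Field K] [Algebra k K] (O : ValuationSubring K) (A : Subalgebra k K),
    (∀ c : k, algebraMap k K c ∈ O) → A.FG → IsFractionRing ↥A K → A.toSubring ≤ O.toSubring →
    ∀ (U : ValuationSubring K), O ≤ U → ∀ (m : ℕ) (𝔭 : Ideal ↥(tower O A m)) [𝔭.IsPrime],
    (∀ x : ↥(tower O A m), x ∈ 𝔭 ↔ (x : K) ∈ U.nonunits) →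
    IsRegularLocalRing (Localization.AtPrime 𝔭) →
    ∃ c ∈ ca (tower O A m), c ≠ 0 ∧ c⁻¹ ∈ U

/-- Statement of `stub_dim2RegularCentre` (v4, provable now): in transcendence degree 2, past a
maximality witness for `O₁ ≠ K`, the centre of `O₁` on a normal stage is a height-one prime with
DVR local ring. [cite: ZariskiSamuel1960, VI §5; Matsumura1986, Thm. 11.2] -/
def Sig.stub_dim2RegularCentre : Prop :=
  ∀ (k K : Type) [Field k] [Field K] [Algebra k K] (O : ValuationSubring K) (A : Subalgebra k K),
    (∀ c : k, algebraMap k K c ∈ O) → A.FG → IsFractionRing ↥A K → A.toSubring ≤ O.toSubring →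
    Algebra.trdeg k K = 2 → ∀ (O₁ : ValuationSubring K), O ≤ O₁ → O₁ ≠ ⊤ →
    ∀ (m₀ : ℕ) (s : K), s ∈ tower O A m₀ → s⁻¹ ∈ O₁ → s⁻¹ ∉ O →
    ∀ (m : ℕ), m₀ < m → ∀ (𝔭 : Ideal ↥(tower O A m)) [𝔭.IsPrime],
    (∀ x : ↥(tower O A m), x ∈ 𝔭 ↔ (x : K) ∈ O₁.nonunits) →
    IsRegularLocalRing (Localization.AtPrime 𝔭)

/-- Statement of `stub_dim2ResidualACC` (v4, provable now): in transcendence degree 2, for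
`O < O₁ < K`, `O` has no infinite strictly ascending chain of principal ideals generated by
`O₁`-units (the residual valuation ring `O/𝔪_{O₁}` is a DVR of the residue field of the prime
divisor `O₁`). [cite: ZariskiSamuel1960, Ch. VI §14, Thm. 31] -/
def Sig.stub_dim2ResidualACC : Prop :=
  ∀ (k K : Type) [Field k] [Field K] [Algebra k K] (O : ValuationSubring K),
    (∀ c : k, algebraMap k K c ∈ O) → (⊤ : IntermediateField k K).FG → Algebra.trdeg k K = 2 →
    ∀ (O₁ : ValuationSubring K), O < O₁ → O₁ ≠ ⊤ →
    ∀ (z : ℕ → K), (∀ n : ℕ, z n ∈ O ∧ z n ≠ 0 ∧ (z n)⁻¹ ∈ O₁) →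
    (∀ n : ℕ, z n * (z (n + 1))⁻¹ ∈ O) → ∃ n : ℕ, z (n + 1) * (z n)⁻¹ ∈ O

/-- Statement of `stub_kernelRankOne` (v3/v4, OPEN — the named risk): the kernel along a maximal
dominator of rank one, transcendence degree ≥ 2. [cite: CutkoskyMourtada2019; HauserPerlega2019; IyengarTakahashi2014, Thm 5.4] -/
def Sig.stub_kernelRankOne : Prop :=
  Persistence → StrictDrop → ∀ p : ℕ, p.Prime → ∀ (k K : Type) [Field k] [CharP k p] [Field K]
    [Algebra k K] (O : ValuationSubring K) (A : Subalgebra k K), (∀ c : k, algebraMap k K c ∈ O) →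
    A.FG → IsFractionRing ↥A K → A.toSubring ≤ O.toSubring →
    (∀ O' : ValuationSubring K,
      (∀ m : ℕ, ∀ s ∈ tower O A m, s ∈ O' ∧ (s⁻¹ ∈ O' → s⁻¹ ∈ O)) → ¬ IsNoetherianRing ↥O') →
    (∀ O' : ValuationSubring K, O < O' → ∃ m : ℕ, ∃ s ∈ tower O A m, s⁻¹ ∈ O' ∧ s⁻¹ ∉ O) →
    (∀ O' : ValuationSubring K, O ≤ O' → O' = O ∨ O' = ⊤) →
    2 ≤ Algebra.trdeg k K →
    ∃ m : ℕ, IsRegularLocalRing ↥(tower O A m)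

/-- Statement of `stub_kernelCompositeHighDim` (v4, OPEN): the kernel along a maximal dominator of
rank ≥ 2 all of whose unit-creating coarsenings have non-discrete residual valuation, transcendence
degree ≥ 3. [cite: CutkoskyMourtada2019; ZariskiSamuel1960, VI §10; IyengarTakahashi2014, Thm 5.4] -/
def Sig.stub_kernelCompositeHighDim : Prop :=
  Persistence → StrictDrop → ∀ p : ℕ, p.Prime → ∀ (k K : Type) [Field k] [CharP k p] [Field K]
    [Algebra k K] (O : ValuationSubring K) (A : Subalgebra k K), (∀ c : k, algebraMap k K c ∈ O) →
    A.FG → IsFractionRing ↥A K → A.toSubring ≤ O.toSubring →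
    (∀ O' : ValuationSubring K,
      (∀ m : ℕ, ∀ s ∈ tower O A m, s ∈ O' ∧ (s⁻¹ ∈ O' → s⁻¹ ∈ O)) → ¬ IsNoetherianRing ↥O') →
    (∀ O' : ValuationSubring K, O < O' → ∃ m : ℕ, ∃ s ∈ tower O A m, s⁻¹ ∈ O' ∧ s⁻¹ ∉ O) →
    (∃ O₁ : ValuationSubring K, O < O₁ ∧ O₁ ≠ ⊤) →
    (∀ U : ValuationSubring K, O ≤ U → (∃ m : ℕ, ∃ c ∈ ca (tower O A m), c ≠ 0 ∧ c⁻¹ ∈ U) →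
      ∃ z : ℕ → K, (∀ n : ℕ, z n ∈ O ∧ z n ≠ 0 ∧ (z n)⁻¹ ∈ U) ∧
        (∀ n : ℕ, z n * (z (n + 1))⁻¹ ∈ O) ∧ ∀ n : ℕ, z (n + 1) * (z n)⁻¹ ∉ O) →
    3 ≤ Algebra.trdeg k K →
    ∃ m : ℕ, IsRegularLocalRing ↥(tower O A m)

/-! ## Landed stubs of v1/v2 (theorems of the tree, entering the composition by name) -/

/-- **Stub (v1; LANDED p167613).** `StrictDrop` terminates the tower along noetherian `O`.
[cite: ZariskiSamuel1960, Ch. VI §10] -/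
theorem stub_noetherianCase (hD : StrictDrop) (p : ℕ) (hp : p.Prime) (k K : Type) [Field k]
    [CharP k p] [Field K] [Algebra k K] (O : ValuationSubring K) (A : Subalgebra k K)
    (hk : ∀ c : k, algebraMap k K c ∈ O) (hA : A.FG) (hfr : IsFractionRing ↥A K)
    (hAO : A.toSubring ≤ O.toSubring) (hN : IsNoetherianRing ↥O) :
    ∃ m : ℕ, IsRegularLocalRing ↥(tower O A m) :=
  Theorems.NoZeno.Birth.stub_noetherianCase hD p hp k K O A hk hA hfr hAO hN

/-- **Stub (v2; LANDED p167526).** Every stage is noetherian. [cite: Liu2002, Prop. 4.1.27] -/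
theorem stub_towerNoetherian (k K : Type) [Field k] [Field K] [Algebra k K]
    (O : ValuationSubring K) (A : Subalgebra k K) (hk : ∀ c : k, algebraMap k K c ∈ O)
    (hA : A.FG) (hfr : IsFractionRing ↥A K) (hAO : A.toSubring ≤ O.toSubring) (m : ℕ) :
    IsNoetherianRing ↥(tower O A m) :=
  Theorems.NoZeno.Birth.stub_towerNoetherian k K O A hk hA hfr hAO m

/-- **Stub (v2; LANDED p168418).** Dominance invariance. [cite: ZariskiSamuel1960, VI §5] -/
theorem stub_dominanceInvariance (k K : Type) [Field k] [Field K] [Algebra k K]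
    (O O' : ValuationSubring K) (A : Subalgebra k K) (hk : ∀ c : k, algebraMap k K c ∈ O)
    (hAO : A.toSubring ≤ O.toSubring) (hN : ∀ m : ℕ, IsNoetherianRing ↥(tower O A m))
    (hdom : ∀ m : ℕ, ∀ s ∈ tower O A m, s ∈ O' ∧ (s⁻¹ ∈ O' → s⁻¹ ∈ O)) (m : ℕ) :
    tower O' A m = tower O A m :=
  Theorems.NoZeno.Birth.stub_dominanceInvariance k K O O' A hk hAO hN hdom m

/-! ## The v3 stubs -/

/-- **Stub `stub_maxDominator` (v3 glue; LANDED p172546, `Theorems/HomologicalConductorNoZenoMaxDominator.lean`).** Among the valuation rings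
`O' ≥ O` dominating the `O`-tower of `A` (`T_m ⊆ O'`, and `O'`-units of `T_m` are `O`-units)
there is a MAXIMAL one `Om`: the family is non-empty (`O`), and the union of a chain of
dominators is a valuation ring (`ValuationSubring.ofLE`) that dominates; Zorn. Maximality
unfolds to: every `O' > Om` fails to dominate, i.e. some `s ∈ T_m` has `s⁻¹ ∈ O' ∖ Om`
(`T_m ⊆ O ≤ O'` by `mem_valuationSubring_of_mem_tower`). [cite: ZariskiSamuel1960, VI §5] -/
theorem stub_maxDominator (k K : Type) [Field k] [Field K] [Algebra k K]
    (O : ValuationSubring K) (A : Subalgebra k K) (hk : ∀ c : k, algebraMap k K c ∈ O)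
    (hAO : A.toSubring ≤ O.toSubring) :
    ∃ Om : ValuationSubring K, O ≤ Om ∧
      (∀ m : ℕ, ∀ s ∈ tower O A m, s ∈ Om ∧ (s⁻¹ ∈ Om → s⁻¹ ∈ O)) ∧
      ∀ O' : ValuationSubring K, Om < O' → ∃ m : ℕ, ∃ s ∈ tower O A m, s⁻¹ ∈ O' ∧ s⁻¹ ∉ Om :=
  Theorems.NoZeno.Birth.stub_maxDominator k K O A hk hAO

/-- **Stub `stub_relativeACC` (v3; LANDED p172572, `Theorems/HomologicalConductorNoZenoRelativeACC.lean`).** `StrictDrop` alone terminates the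
tower along `O` as soon as (i) some `ca(T_m₀)` contains a nonzero `c` with `c⁻¹ ∈ U` for an
overring `U ≥ O`, and (ii) `O` has no infinite strictly ascending chain of principal ideals
`(z₀) ⊊ (z₁) ⊊ ⋯` with all `zₙ⁻¹ ∈ U`. Proof: were every stage singular, iterate `StrictDrop`
from `z₀ = c`: the drop `y ∈ ca(T_m')` with `y · zₙ⁻¹ ∉ O` has `zₙ · y⁻¹ ∈ O`, hence
`y⁻¹ = zₙ⁻¹ · (zₙ y⁻¹) ∈ U`; the `zₙ` form a chain forbidden by (ii). With `U = O` noetherian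
this is `stub_noetherianCase`; the point is that only the units of the COARSENING `U` and the
chain condition of the residual valuation `O/𝔭_U` are used. [cite: ZariskiSamuel1960, Ch. VI §10] -/
theorem stub_relativeACC (hD : StrictDrop) (p : ℕ) (hp : p.Prime) (k K : Type) [Field k]
    [CharP k p] [Field K] [Algebra k K] (O : ValuationSubring K) (A : Subalgebra k K)
    (hk : ∀ c : k, algebraMap k K c ∈ O) (hA : A.FG) (hfr : IsFractionRing ↥A K)
    (hAO : A.toSubring ≤ O.toSubring) (U : ValuationSubring K) (hOU : O ≤ U)
    (hunit : ∃ m : ℕ, ∃ c ∈ ca (tower O A m), c ≠ 0 ∧ c⁻¹ ∈ U)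
    (hacc : ∀ z : ℕ → K, (∀ n : ℕ, z n ∈ O ∧ z n ≠ 0 ∧ (z n)⁻¹ ∈ U) →
      (∀ n : ℕ, z n * (z (n + 1))⁻¹ ∈ O) → ∃ n : ℕ, z (n + 1) * (z n)⁻¹ ∈ O) :
    ∃ m : ℕ, IsRegularLocalRing ↥(tower O A m) :=
  Theorems.NoZeno.Birth.stub_relativeACC hD p hp k K O A hk hA hfr hAO U hOU hunit hacc

/-- **Stub `stub_kernelLowDim` (v4; provable now, size S/M).** In transcendence degree `≤ 1` every
valuation ring `O ∋ k` of the finitely generated `K/k` is noetherian: `O = K` is a field, and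
`O ≠ K` has `residueTrdeg + 1 = trdeg` (tree `residueTrdeg_add_one_eq_of_trdeg_le_one`) hence is a
DVR (tree `isDiscreteValuationRing_of_residueTrdeg`, Zariski–Samuel VI §14 Thm 31;
`(⊤ : IntermediateField k K).FG` from `A.FG` by `IntermediateField.fg_top_of_isFractionRing_of_finiteType`).
Since `O` dominates its own tower (`T_m ⊆ O`), the kernel hypothesis `hker O` is contradicted.
[cite: ZariskiSamuel1960, Ch. VI §14, Thm. 31] -/
theorem stub_kernelLowDim (k K : Type) [Field k] [Field K] [Algebra k K] (O : ValuationSubring K)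
    (A : Subalgebra k K) (hk : ∀ c : k, algebraMap k K c ∈ O) (hA : A.FG)
    (hfr : IsFractionRing ↥A K) (hAO : A.toSubring ≤ O.toSubring)
    (hker : ∀ O' : ValuationSubring K,
      (∀ m : ℕ, ∀ s ∈ tower O A m, s ∈ O' ∧ (s⁻¹ ∈ O' → s⁻¹ ∈ O)) → ¬ IsNoetherianRing ↥O')
    (htr : Algebra.trdeg k K ≤ 1) : ∃ m : ℕ, IsRegularLocalRing ↥(tower O A m) := by
  sorry

/-- **Stub `stub_singEqVCa` (v4; the tree's named-fact DEBT).** Iyengar–Takahashi 2014, Theorem 5.4: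
`V(ca R) = V(ca^{2d+1} R) = Sing R` for localisations `R` of finitely generated algebras over a field
(`Literature/RingTheory/CohomologyAnnihilator/AnnihilationOfCohomology.lean`, reduced to three printed
inputs in `StrongGeneratorReduction.lean`). Used only through `stub_unitOfRegularCentre`.
[cite: IyengarTakahashi2014, Thm. 5.4] -/
theorem stub_singEqVCa : Literature.RingTheory.CohomologyAnnihilator.singEqVCa_essFiniteType.{0} := by
  sorry

/-- **Stub `stub_unitOfRegularCentre` (v4; provable now from Thm 5.4, size M).** `T_m` is essentially
of finite type over `k` (`tn_tower_invariant`), i.e. a localisation of a finitely generated subalgebra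
`A' = k[s₁,…,s_r] ⊆ T_m` (`Algebra.EssFiniteType`), of some Krull dimension `d`
(`exists_ringKrullDim_eq_and_trdeg_eq`); Theorem 5.4 at the prime `𝔭` gives
`ca(T_m) ≤ 𝔭 ↔ ¬ regular (T_m)_𝔭`, so regularity yields `c ∈ cohomologyAnnihilator T_m`, `c ∉ 𝔭`;
then `(c : K) ∈ ca (tower O A m)` (`tn_coe_mem_ca_iff`), `c ≠ 0`, and `c ∉ U.nonunits` with
`c ∈ T_m ⊆ O ≤ U` gives `c⁻¹ ∈ U` (`ValuationSubring.mem_nonunits_iff_or`). [cite: IyengarTakahashi2014, Thm. 5.4] -/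
theorem stub_unitOfRegularCentre
    (h54 : Literature.RingTheory.CohomologyAnnihilator.singEqVCa_essFiniteType.{0})
    (k K : Type) [Field k] [Field K] [Algebra k K] (O : ValuationSubring K) (A : Subalgebra k K)
    (hk : ∀ c : k, algebraMap k K c ∈ O) (hA : A.FG) (hfr : IsFractionRing ↥A K)
    (hAO : A.toSubring ≤ O.toSubring) (U : ValuationSubring K) (hOU : O ≤ U) (m : ℕ)
    (𝔭 : Ideal ↥(tower O A m)) [𝔭.IsPrime] (h𝔭 : ∀ x : ↥(tower O A m), x ∈ 𝔭 ↔ (x : K) ∈ U.nonunits)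
    (hreg : IsRegularLocalRing (Localization.AtPrime 𝔭)) :
    ∃ c ∈ ca (tower O A m), c ≠ 0 ∧ c⁻¹ ∈ U := by
  sorry

/-- **Stub `stub_dim2RegularCentre` (v4; provable now, size M/L).** `T = T_m` (`m > m₀ ≥ 0`) is a
normal noetherian local domain (`isIntegrallyClosed_nrm`, `isIntegrallyClosed_locAt`), essentially of
finite type over `k` with `Frac T = K` of transcendence degree 2, so `dim T ≤ 2`
(`ringKrullDim_le_of_fg_of_trdeg_le` on a finitely generated model + `IsLocalization.ringKrullDim_le`).
The prime `𝔭` (centre of `O₁`) is not maximal — the witness `s ∈ T_{m₀} ⊆ T_m` is a non-unit of `T`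
(`s⁻¹ ∉ O ⊇ T`) outside `𝔭` (`s⁻¹ ∈ O₁`) — and not zero (`O₁ ≠ K = Frac T`); hence `height 𝔭 = 1`
and `T_𝔭` is a DVR (`isDiscreteValuationRing_localization_of_height_eq_one`), in particular regular
(Mathlib instance for local PIDs). [cite: Matsumura1986, Thm. 11.2; ZariskiSamuel1960, VI §5] -/
theorem stub_dim2RegularCentre (k K : Type) [Field k] [Field K] [Algebra k K]
    (O : ValuationSubring K) (A : Subalgebra k K) (hk : ∀ c : k, algebraMap k K c ∈ O) (hA : A.FG)
    (hfr : IsFractionRing ↥A K) (hAO : A.toSubring ≤ O.toSubring) (htr : Algebra.trdeg k K = 2)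
    (O₁ : ValuationSubring K) (hOO₁ : O ≤ O₁) (hne : O₁ ≠ ⊤) (m₀ : ℕ) (s : K)
    (hs : s ∈ tower O A m₀) (hsU : s⁻¹ ∈ O₁) (hsO : s⁻¹ ∉ O) (m : ℕ) (hm : m₀ < m)
    (𝔭 : Ideal ↥(tower O A m)) [𝔭.IsPrime]
    (h𝔭 : ∀ x : ↥(tower O A m), x ∈ 𝔭 ↔ (x : K) ∈ O₁.nonunits) :
    IsRegularLocalRing (Localization.AtPrime 𝔭) := by
  sorry

/-- **Stub `stub_dim2ResidualACC` (v4; provable now, size M/L).** `O₁` is a prime divisor of `K/k`: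
the residual valuation ring `Ō = residueValuationSubring O O₁ _` of `κ(O₁)` is `≠ ⊤` (as `O ≠ O₁`)
and contains `k`, so `κ(O₁)/k` is not algebraic, `residueTrdeg O₁ ≥ 1`; with
`ratRank O₁ ≥ 1` (`one_le_ratRank_of_ne_top`) and Abhyankar's inequality
(`ratRank_add_residueTrdeg_le_trdeg`) `residueTrdeg O₁ = 1 = trdeg − 1`, so `κ(O₁)/k` is finitely
generated of transcendence degree 1 (`residueField_fg_of_residueTrdeg`) and `Ō` is a DVR
(`residueTrdeg_add_one_eq_of_trdeg_le_one` + `isDiscreteValuationRing_of_residueTrdeg` over `κ(O₁)`),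
hence noetherian: the chain of principal ideals `(z̄ₙ)` (`zₙ` are `O₁`-units, and for such
`y/x ∈ O ↔ ȳ/x̄ ∈ Ō`, `residue_mem_residueValuationSubring_iff`) cannot ascend strictly for ever.
[cite: ZariskiSamuel1960, Ch. VI §14, Thm. 31] -/
theorem stub_dim2ResidualACC (k K : Type) [Field k] [Field K] [Algebra k K] (O : ValuationSubring K)
    (hk : ∀ c : k, algebraMap k K c ∈ O) (hKfg : (⊤ : IntermediateField k K).FG)
    (htr : Algebra.trdeg k K = 2) (O₁ : ValuationSubring K) (hlt : O < O₁) (hne : O₁ ≠ ⊤)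
    (z : ℕ → K) (hz : ∀ n : ℕ, z n ∈ O ∧ z n ≠ 0 ∧ (z n)⁻¹ ∈ O₁)
    (hle : ∀ n : ℕ, z n * (z (n + 1))⁻¹ ∈ O) : ∃ n : ℕ, z (n + 1) * (z n)⁻¹ ∈ O := by
  sorry

/-- **Stub `stub_kernelRankOne` (v3/v4; OPEN, load-bearing — the crux's named risk).** Along a
valuation ring `O` that is (a) dominated-maximal for its own tower (no `O' > O` dominates: every
proper coarsening eventually has non-maximal centre), (b) of rank one (`O ≤ O' ⇒ O' ∈ {O, K}`),
(c) such that no noetherian valuation ring dominates the tower (so `O` is rank-one NON-DISCRETE),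
in transcendence degree ≥ 2, `Persistence` and `StrictDrop` still force a regular stage. Order
theory is exhausted here (Disproof F1: `γ_m = 2^{-m}`); a proof needs arithmetic of `ca(T_m)` along
defect / irrational valuations (bounded denominators, or a second invariant), a refutation needs a
self-similar normalised `ca`-blow-up. [cite: CutkoskyMourtada2019; HauserPerlega2019;
IyengarTakahashi2014, Thm 5.4] -/
theorem stub_kernelRankOne (hP : Persistence) (hD : StrictDrop) (p : ℕ) (hp : p.Prime)
    (k K : Type) [Field k] [CharP k p] [Field K] [Algebra k K] (O : ValuationSubring K)
    (A : Subalgebra k K) (hk : ∀ c : k, algebraMap k K c ∈ O) (hA : A.FG)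
    (hfr : IsFractionRing ↥A K) (hAO : A.toSubring ≤ O.toSubring)
    (hker : ∀ O' : ValuationSubring K,
      (∀ m : ℕ, ∀ s ∈ tower O A m, s ∈ O' ∧ (s⁻¹ ∈ O' → s⁻¹ ∈ O)) → ¬ IsNoetherianRing ↥O')
    (hmax : ∀ O' : ValuationSubring K, O < O' → ∃ m : ℕ, ∃ s ∈ tower O A m, s⁻¹ ∈ O' ∧ s⁻¹ ∉ O)
    (hrk : ∀ O' : ValuationSubring K, O ≤ O' → O' = O ∨ O' = ⊤)
    (htr : 2 ≤ Algebra.trdeg k K) :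
    ∃ m : ℕ, IsRegularLocalRing ↥(tower O A m) := by
  sorry

/-- **Stub `stub_kernelCompositeHighDim` (v4; OPEN).** Along a dominated-maximal `O` of rank ≥ 2
(`O < O₁ < K` for some `O₁`), no noetherian dominator, transcendence degree ≥ 3, and such that for
EVERY overring `U ≥ O` in which some nonzero element of some `ca(T_m)` is a unit, `O` has an
infinite strictly ascending chain of principal ideals generated by `U`-units, `Persistence` and
`StrictDrop` force a regular stage. Needed (KERNEL-c1.md §4): (a) the `O`-tower resolves the
centre of the immediate coarsening (false in general for arbitrary ideals since `ca` does not
localise — `Theorems/Globalisation/Negative/CuspCylinderCertificate.lean` — but asked only for the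
canonical tower), and (b) control of non-discrete residual valuations. [cite: CutkoskyMourtada2019;
ZariskiSamuel1960, VI §10; IyengarTakahashi2014, Thm 5.4] -/
theorem stub_kernelCompositeHighDim (hP : Persistence) (hD : StrictDrop) (p : ℕ) (hp : p.Prime)
    (k K : Type) [Field k] [CharP k p] [Field K] [Algebra k K] (O : ValuationSubring K)
    (A : Subalgebra k K) (hk : ∀ c : k, algebraMap k K c ∈ O) (hA : A.FG)
    (hfr : IsFractionRing ↥A K) (hAO : A.toSubring ≤ O.toSubring)
    (hker : ∀ O' : ValuationSubring K,
      (∀ m : ℕ, ∀ s ∈ tower O A m, s ∈ O' ∧ (s⁻¹ ∈ O' → s⁻¹ ∈ O)) → ¬ IsNoetherianRing ↥O')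
    (hmax : ∀ O' : ValuationSubring K, O < O' → ∃ m : ℕ, ∃ s ∈ tower O A m, s⁻¹ ∈ O' ∧ s⁻¹ ∉ O)
    (hrk : ∃ O₁ : ValuationSubring K, O < O₁ ∧ O₁ ≠ ⊤)
    (hcore : ∀ U : ValuationSubring K, O ≤ U →
      (∃ m : ℕ, ∃ c ∈ ca (tower O A m), c ≠ 0 ∧ c⁻¹ ∈ U) →
      ∃ z : ℕ → K, (∀ n : ℕ, z n ∈ O ∧ z n ≠ 0 ∧ (z n)⁻¹ ∈ U) ∧
        (∀ n : ℕ, z n * (z (n + 1))⁻¹ ∈ O) ∧ ∀ n : ℕ, z (n + 1) * (z n)⁻¹ ∉ O)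
    (htr : 3 ≤ Algebra.trdeg k K) :
    ∃ m : ℕ, IsRegularLocalRing ↥(tower O A m) := by
  sorry

/-! ## The composition (kernel-checked; no `sorry` in its own term) -/

/-- **`NoZeno` from the v4 stubs** — pure logic and dimension bookkeeping over the landed stubs
(`stub_maxDominator`, `stub_relativeACC` enter by name):
(1) a noetherian dominator `O'` ⇒ `tower O' A = tower O A` (invariance) and `stub_noetherianCase`;
(2) otherwise pass to a maximal dominator `Om` (`stub_maxDominator`; same tower by invariance; the
kernel hypothesis and maximality transfer); with `n = trdeg_k K = dim A`: (3) `n ≤ 1` ⇒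
`stub_kernelLowDim`; (4) `Om` of rank ≥ 2 and `n = 2` ⇒ the centre of an intermediate `O₁` on the
stage past the maximality witness is regular (`stub_dim2RegularCentre`), so `ca` there holds an
`O₁`-unit (`stub_unitOfRegularCentre` fed by `stub_singEqVCa`), and the residual chain condition
(`stub_dim2ResidualACC`) lets `stub_relativeACC` terminate the tower; (5) rank ≥ 2 and `n ≥ 3` ⇒
`stub_relativeACC` if some overring qualifies, else `stub_kernelCompositeHighDim`; (6) rank one ⇒
`stub_kernelRankOne`. [folklore] -/
theorem NoZeno_of : Sig.stub_kernelLowDim → Sig.stub_singEqVCa → Sig.stub_unitOfRegularCentre →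
    Sig.stub_dim2RegularCentre → Sig.stub_dim2ResidualACC → Sig.stub_kernelRankOne →
    Sig.stub_kernelCompositeHighDim → NoZeno := by
  intro hLow hS54 hUnit hReg hAcc hR1 hC hP hD p hp k K _ _ _ _ O A hk hfg hfr hAO
  show ∃ m : ℕ, IsRegularLocalRing ↥(tower O A m)
  -- the two LANDED v3 stubs, by name
  have hMax : Sig.stub_maxDominator := fun k K _ _ _ O A hk hAO => stub_maxDominator k K O A hk hAO
  have hL : Sig.stub_relativeACC := fun hD p hp k K _ _ _ _ O A hk hA hfr hAO U hOU hunit hacc =>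
    stub_relativeACC hD p hp k K O A hk hA hfr hAO U hOU hunit hacc
  have hN : ∀ n : ℕ, IsNoetherianRing ↥(tower O A n) :=
    fun n => stub_towerNoetherian k K O A hk hfg hfr hAO n
  -- (1) some noetherian valuation ring dominates the tower
  by_cases h : ∃ O' : ValuationSubring K, IsNoetherianRing ↥O' ∧
      ∀ m : ℕ, ∀ s ∈ tower O A m, s ∈ O' ∧ (s⁻¹ ∈ O' → s⁻¹ ∈ O)
  · obtain ⟨O', hNO', hdom⟩ := h
    have hTeq : ∀ m : ℕ, tower O' A m = tower O A m := fun m =>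
      stub_dominanceInvariance k K O O' A hk hAO hN hdom m
    have hk' : ∀ c : k, algebraMap k K c ∈ O' :=
      fun c => (hdom 0 _ ((tower O A 0).algebraMap_mem c)).1
    have hAO' : A.toSubring ≤ O'.toSubring :=
      fun a ha => (hdom 0 a (le_tower_zero O A ha)).1
    obtain ⟨m, hm⟩ := stub_noetherianCase hD p hp k K O' A hk' hfg hfr hAO' hNO'
    exact ⟨m, hTeq m ▸ hm⟩
  -- the kernel hypothesis along `O`
  have hker : ∀ O' : ValuationSubring K,
      (∀ m : ℕ, ∀ s ∈ tower O A m, s ∈ O' ∧ (s⁻¹ ∈ O' → s⁻¹ ∈ O)) → ¬ IsNoetherianRing ↥O' :=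
    fun O' hdom hNO' => h ⟨O', hNO', hdom⟩
  -- (2) pass to a maximal dominator `Om`
  obtain ⟨Om, hOOm, hdom, hmax⟩ := hMax k K O A hk hAO
  have hTeq : ∀ m : ℕ, tower Om A m = tower O A m := fun m =>
    stub_dominanceInvariance k K O Om A hk hAO hN hdom m
  have hkm : ∀ c : k, algebraMap k K c ∈ Om := fun c => hOOm (hk c)
  have hAOm : A.toSubring ≤ Om.toSubring := fun a ha => hOOm (hAO ha)
  have hkerm : ∀ O' : ValuationSubring K,
      (∀ m : ℕ, ∀ s ∈ tower Om A m, s ∈ O' ∧ (s⁻¹ ∈ O' → s⁻¹ ∈ Om)) →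
        ¬ IsNoetherianRing ↥O' := by
    intro O' hdom'
    refine hker O' fun m s hs => ?_
    have hs' : s ∈ tower Om A m := hTeq m ▸ hs
    exact ⟨(hdom' m s hs').1, fun hi => (hdom m s hs).2 ((hdom' m s hs').2 hi)⟩
  have hmaxm : ∀ O' : ValuationSubring K, Om < O' →
      ∃ m : ℕ, ∃ s ∈ tower Om A m, s⁻¹ ∈ O' ∧ s⁻¹ ∉ Om := by
    intro O' hlt
    obtain ⟨m, s, hs, h1, h2⟩ := hmax O' hlt
    exact ⟨m, s, hTeq m ▸ hs, h1, h2⟩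
  suffices hgoal : ∃ m : ℕ, IsRegularLocalRing ↥(tower Om A m) by
    obtain ⟨m, hm⟩ := hgoal
    exact ⟨m, hTeq m ▸ hm⟩
  -- dimension bookkeeping: `n = trdeg_k K = trdeg_k A = dim A`
  haveI : IsFractionRing ↥A K := hfr
  haveI : Algebra.FiniteType k ↥A := A.fg_iff_finiteType.mp hfg
  obtain ⟨n, -, hnA⟩ := Literature.AlgebraicGeometry.Resolution.exists_ringKrullDim_eq_and_trdeg_eq k ↥A
  have htrK : Algebra.trdeg k K = n :=
    (Literature.AlgebraicGeometry.Resolution.trdeg_eq_trdeg_of_isFractionRing A).trans hnA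
  have hKfg : (⊤ : IntermediateField k K).FG :=
    Literature.AlgebraicGeometry.Resolution.IntermediateField.fg_top_of_isFractionRing_of_finiteType
      k ↥A K
  -- (3) transcendence degree ≤ 1
  by_cases hlow : n ≤ 1
  · exact hLow k K Om A hkm hfg hfr hAOm hkerm (by rw [htrK]; exact_mod_cast hlow)
  -- the relative chain condition, if it fails for every overring
  have hcore_of : (¬ ∃ U : ValuationSubring K, Om ≤ U ∧
      (∃ m : ℕ, ∃ c ∈ ca (tower Om A m), c ≠ 0 ∧ c⁻¹ ∈ U) ∧
      ∀ z : ℕ → K, (∀ n : ℕ, z n ∈ Om ∧ z n ≠ 0 ∧ (z n)⁻¹ ∈ U) →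
        (∀ n : ℕ, z n * (z (n + 1))⁻¹ ∈ Om) → ∃ n : ℕ, z (n + 1) * (z n)⁻¹ ∈ Om) →
      ∀ U : ValuationSubring K, Om ≤ U →
      (∃ m : ℕ, ∃ c ∈ ca (tower Om A m), c ≠ 0 ∧ c⁻¹ ∈ U) →
      ∃ z : ℕ → K, (∀ n : ℕ, z n ∈ Om ∧ z n ≠ 0 ∧ (z n)⁻¹ ∈ U) ∧
        (∀ n : ℕ, z n * (z (n + 1))⁻¹ ∈ Om) ∧ ∀ n : ℕ, z (n + 1) * (z n)⁻¹ ∉ Om := by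
    intro hacc U hU hunit
    by_contra hz
    push Not at hz
    exact hacc ⟨U, hU, hunit, fun z h1 h2 => hz z h1 h2⟩
  -- (4)/(5)/(6) split on the rank of `Om`
  by_cases hrk : ∃ O₁ : ValuationSubring K, Om < O₁ ∧ O₁ ≠ ⊤
  · by_cases h2 : n = 2
    · -- (4) composite, transcendence degree 2: PROVED modulo the v4 stubs
      have htr2 : Algebra.trdeg k K = 2 := by rw [htrK, h2]; norm_cast
      obtain ⟨O₁, hlt1, hne1⟩ := hrk
      have hOU : Om ≤ O₁ := hlt1.le
      obtain ⟨m₀, s, hs, hsU, hsO⟩ := hmaxm O₁ hlt1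
      have hTO : (tower Om A (m₀ + 1)).toSubring ≤ O₁.toSubring := fun x hx =>
        hOU (mem_valuationSubring_of_mem_tower Om hkm hAOm (m₀ + 1) x hx)
      let 𝔭 : Ideal ↥(tower Om A (m₀ + 1)) :=
        Literature.AlgebraicGeometry.Resolution.centreIdeal (tower Om A (m₀ + 1)) O₁ hTO
      have h𝔭 : ∀ x : ↥(tower Om A (m₀ + 1)), x ∈ 𝔭 ↔ (x : K) ∈ O₁.nonunits := fun x =>
        Literature.AlgebraicGeometry.Resolution.mem_centreIdeal_iff_coe_mem_nonunits _ O₁ hTO x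
      have hreg : IsRegularLocalRing (Localization.AtPrime 𝔭) :=
        hReg k K Om A hkm hfg hfr hAOm htr2 O₁ hOU hne1 m₀ s hs hsU hsO (m₀ + 1)
          (Nat.lt_succ_self m₀) 𝔭 h𝔭
      have hunit : ∃ m : ℕ, ∃ c ∈ ca (tower Om A m), c ≠ 0 ∧ c⁻¹ ∈ O₁ :=
        ⟨m₀ + 1, hUnit hS54 k K Om A hkm hfg hfr hAOm O₁ hOU (m₀ + 1) 𝔭 h𝔭 hreg⟩
      exact hL hD p hp k K Om A hkm hfg hfr hAOm O₁ hOU hunit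
        (fun z hz hle => hAcc k K Om hkm hKfg htr2 O₁ hlt1 hne1 z hz hle)
    · -- (5) composite, transcendence degree ≥ 3
      have htr3 : 3 ≤ Algebra.trdeg k K := by
        rw [htrK]; exact_mod_cast (by omega : 3 ≤ n)
      by_cases hacc : ∃ U : ValuationSubring K, Om ≤ U ∧
          (∃ m : ℕ, ∃ c ∈ ca (tower Om A m), c ≠ 0 ∧ c⁻¹ ∈ U) ∧
          ∀ z : ℕ → K, (∀ n : ℕ, z n ∈ Om ∧ z n ≠ 0 ∧ (z n)⁻¹ ∈ U) →
            (∀ n : ℕ, z n * (z (n + 1))⁻¹ ∈ Om) → ∃ n : ℕ, z (n + 1) * (z n)⁻¹ ∈ Om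
      · obtain ⟨U, hU, hunit, hch⟩ := hacc
        exact hL hD p hp k K Om A hkm hfg hfr hAOm U hU hunit hch
      · exact hC hP hD p hp k K Om A hkm hfg hfr hAOm hkerm hmaxm hrk (hcore_of hacc) htr3
  · -- (6) rank one, transcendence degree ≥ 2
    have htr2 : 2 ≤ Algebra.trdeg k K := by
      rw [htrK]; exact_mod_cast (by omega : 2 ≤ n)
    refine hR1 hP hD p hp k K Om A hkm hfg hfr hAOm hkerm hmaxm (fun O' hle => ?_) htr2
    by_cases heq : O' = Om
    · exact Or.inl heq
    · right
      by_contra htop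
      exact hrk ⟨O', lt_of_le_of_ne hle (Ne.symm heq), htop⟩

/-- **The crux `NoZeno`, assembled** (the skeleton in its final shape; the only `sorry`s in its
closure are the open v4 stubs). -/
theorem NoZeno_proof : NoZeno :=
  NoZeno_of stub_kernelLowDim stub_singEqVCa stub_unitOfRegularCentre stub_dim2RegularCentre
    stub_dim2ResidualACC stub_kernelRankOne stub_kernelCompositeHighDim

end Summit.ResolutionOfSingularities.ResolutionOfSingularities.Cruxes.NoZeno.Lines.Birth

end
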